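import Literature.Computability.AlgebraicComplexity.BI17SL3InvariantDimensionProofs
import Literature.Computability.AlgebraicComplexity.BI17DegreeExponentMonoidProofs
import Literature.Computability.AlgebraicComplexity.BI17ChowPowerSumPolystableProofs
import HarnessLib

/-!
# `e(m) > 0`: every `⊗³ℂ^m`, `m ≥ 1`, carries a non-constant `SL³_m`-invariant — and the
# discharge of `BI2017_thm_5_9` (Bürgisser–Ikenmeyer 2017, Thm. 5.9)

Sibling proof file (theorems and proof plumbing only; no named facts) of
`Literature/Computability/AlgebraicComplexity/BI17FundamentalInvariantTensors.lean` (cell `val-lit`,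
DAG row BI17-B), discharging its named fact
`Literature.Computability.AlgebraicComplexity.BI2017_thm_5_9`:
P. Bürgisser, C. Ikenmeyer, *Fundamental invariants of orbit closures*, J. Algebra **477** (2017)
390–434 = arXiv:1511.02927, Thm. 5.9 (main.tex L2122, p0019:L3): "1. We have `⌈√m⌉ ≤ e'(m)` if
`m > 2`. 2. We have `e'(m) ≤ m` if [`AT(m)`] holds for `m`. 3. If `m = n²`, then `k_{n²}(n) = 1`. In
particular, `e'(n²) = n`."

The sibling `BI17SL3InvariantDimensionProofs.lean` proves parts (2), (3), and part (1) *given* the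
positivity of the generic minimal degree `e(m)` (`BI2017_thm_5_9_of_pos`): the typed part (1),
`m ∣ e(m) ∧ m ≤ (e(m)/m)²`, reads `e(m)` as "the minimal positive element of
`E(m) = {d | O(⊗³ℂ^m)^{SL³_m}_d ≠ 0}`" (BI 2017 eq. (5.1), L2005–2008), which in print is tacitly
nonempty ("`e'(m)` is the minimal `δ` with `k_m(δ) > 0`"). This file proves that residual:

  `genericTensorMinimalDegree_pos : 0 < m → 0 < genericTensorMinimalDegree (Fin m) ℂ`,

i.e. for every `m ≥ 1` there is a nonzero homogeneous `SL_m × SL_m × SL_m`-invariant polynomial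
function of positive degree on `⊗³ℂ^m`, and assembles `BI2017_thm_5_9_holds : BI2017_thm_5_9`.

## Proof (slice-determinant transfer from forms to tensors)

Classical invariant theory, no Kronecker coefficients: to a cubic tensor `w ∈ ⊗³ℂ^m` attach the
form of degree `m` in `m` variables

  `S(w) := det(∑_a x_a · w(a,·,·)) ∈ Sym^m ℂ^m`      (`tensorSliceDet`),

the determinant of the generic element of the first slice pencil of `w`. Under
`(g₁, g₂, g₃) ∈ GL_m³` (the tree's `actTensor`, `(g₁ ⊗ g₂ ⊗ g₃)·w`) the slice matrix transforms as
`M(w) ↦ g₂ · (g₁ · M(w)) · g₃ᵀ`, where `g₁ · _` is the tree's linear substitution of variables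
`linSubst g₁` (`tensorSliceMatrix_actTensor_fst/snd/thd`), so
`S((g₁,g₂,g₃)·w) = det g₂ · det g₃ · (g₁ · S(w))` (`tensorSliceDet_actTensor`), and
`S(⟨m⟩) = x_1 ⋯ x_m` at the unit tensor (`tensorSliceDet_unitTensor`). Hence for every homogeneous
`SL_m`-invariant `F` of degree `d` on `Sym^m ℂ^m` the polynomial function `Φ_F(w) := F(S(w))` on
`⊗³ℂ^m` — as a polynomial in the `m³` coordinates: `F` with the coordinate `X_μ` replaced by the
`x^μ`-coefficient of `det(∑_a x_a ⊗ X_{(a,b,c)})`, `sliceDetTransfer F` — is `SL³_m`-invariant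
(`isSL3Invariant_sliceDetTransfer`), homogeneous of degree `m d` (the Leibniz expansion exhibits each
coefficient of the generic slice determinant as a signed sum of monomials of degree `m`,
`isHomogeneous_coeff_genericSliceDet`), and takes the value `F(x_1⋯x_m)` at `⟨m⟩`
(`aeval_unitTensor_sliceDetTransfer`). By Hilbert's nonvanishing for the polystable Chow monomial
`x_1⋯x_m` (BI 2017 Cor. 2.9, the tree's `isPolystable_prod_X`; Mumford–Fogarty–Kirwan Ch. 2 §1
Prop. 2.2 as proved in `BI17DegreeExponentMonoidProofs.lean`,
`exists_isSLInvariantCoord_aeval_formCoeff_ne_zero`) there is such an `F` with `d > 0` and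
`F(x_1⋯x_m) ≠ 0`, so `Φ_F ≠ 0`, `m d ∈ E(m)` and `e(m) > 0`.

Honest framing: bookkeeping in classical invariant theory; nothing here bears on VP versus VNP.

## References

* [BurgisserIkenmeyer2017] P. Bürgisser, C. Ikenmeyer, *Fundamental invariants of orbit closures*,
  J. Algebra 477 (2017) 390–434; arXiv:1511.02927, §5 eq. (5.1), Thm. 5.9, Cor. 2.9.
* [MumfordFogartyKirwan1994] D. Mumford, J. Fogarty, F. Kirwan, *Geometric Invariant Theory*,
  3rd ed., Springer 1994, Ch. 2 §1 Prop. 2.2.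
-/

noncomputable section

open MvPolynomial

namespace Literature.Computability.AlgebraicComplexity

/-! ### The slice determinant of a cubic tensor -/

section SliceDet

variable {m : ℕ}

/-- The **slice matrix** `M(w) := ∑_a x_a · w(a,·,·)` of a cubic tensor `w ∈ ⊗³ℂ^m` — the generic
element of its first slice pencil — with entries the linear forms `∑_a w(a,b,c) x_a ∈ ℂ[x_1,…,x_m]`.
[cite: BurgisserIkenmeyer2017, §5 eq. (5.1)] -/
def tensorSliceMatrix (w : Fin m → Fin m → Fin m → ℂ) :
    Matrix (Fin m) (Fin m) (MvPolynomial (Fin m) ℂ) :=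
  Matrix.of fun b c => ∑ a, X a * C (w a b c)

/-- The **slice determinant** `S(w) := det(∑_a x_a · w(a,·,·)) ∈ Sym^m ℂ^m` of a cubic tensor
`w ∈ ⊗³ℂ^m`, a form of degree `m` in `x_1,…,x_m`. [cite: BurgisserIkenmeyer2017, §5 eq. (5.1)] -/
def tensorSliceDet (w : Fin m → Fin m → Fin m → ℂ) : MvPolynomial (Fin m) ℂ :=
  (tensorSliceMatrix w).det

/-- Entries of the slice matrix. [cite: BurgisserIkenmeyer2017, §5 eq. (5.1)] -/
theorem tensorSliceMatrix_apply (w : Fin m → Fin m → Fin m → ℂ) (b c : Fin m) :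
    tensorSliceMatrix w b c = ∑ a, X a * C (w a b c) :=
  rfl

/-- `g₃` in the third factor multiplies the slice matrix by `g₃ᵀ` on the right:
`M((1 ⊗ 1 ⊗ g₃)·w) = M(w) · g₃ᵀ`. [cite: BurgisserIkenmeyer2017, §5 eq. (5.1)] -/
theorem tensorSliceMatrix_actTensor_thd (G : Matrix (Fin m) (Fin m) ℂ)
    (w : Fin m → Fin m → Fin m → ℂ) :
    tensorSliceMatrix (actTensor (1 : Matrix (Fin m) (Fin m) ℂ) (1 : Matrix (Fin m) (Fin m) ℂ) G w) =
      tensorSliceMatrix w * (G.map C).transpose := by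
  refine Matrix.ext fun b c => ?_
  simp only [tensorSliceMatrix_apply, actTensor_thd_apply, Matrix.mul_apply, Matrix.transpose_apply,
    Matrix.map_apply, map_sum, map_mul, Finset.mul_sum, Finset.sum_mul]
  rw [Finset.sum_comm]
  exact Finset.sum_congr rfl fun c' _ => Finset.sum_congr rfl fun a _ => by ring

/-- `g₂` in the second factor multiplies the slice matrix by `g₂` on the left:
`M((1 ⊗ g₂ ⊗ 1)·w) = g₂ · M(w)`. [cite: BurgisserIkenmeyer2017, §5 eq. (5.1)] -/
theorem tensorSliceMatrix_actTensor_snd (B : Matrix (Fin m) (Fin m) ℂ)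
    (w : Fin m → Fin m → Fin m → ℂ) :
    tensorSliceMatrix (actTensor (1 : Matrix (Fin m) (Fin m) ℂ) B (1 : Matrix (Fin m) (Fin m) ℂ) w) =
      B.map C * tensorSliceMatrix w := by
  refine Matrix.ext fun b c => ?_
  simp only [tensorSliceMatrix_apply, actTensor_snd_apply, Matrix.mul_apply, Matrix.map_apply,
    map_sum, map_mul, Finset.mul_sum]
  rw [Finset.sum_comm]
  exact Finset.sum_congr rfl fun b' _ => Finset.sum_congr rfl fun a _ => by ring

/-- `g₁` in the first factor acts on the slice matrix entrywise by the linear substitution of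
variables `x_{a'} ↦ ∑_a (g₁)_{a a'} x_a` (the tree's `linSubst g₁`):
`M((g₁ ⊗ 1 ⊗ 1)·w) = g₁ · M(w)`. [cite: BurgisserIkenmeyer2017, §5 eq. (5.1)] -/
theorem tensorSliceMatrix_actTensor_fst (A : Matrix (Fin m) (Fin m) ℂ)
    (w : Fin m → Fin m → Fin m → ℂ) :
    tensorSliceMatrix (actTensor A (1 : Matrix (Fin m) (Fin m) ℂ) (1 : Matrix (Fin m) (Fin m) ℂ) w) =
      (tensorSliceMatrix w).map (linSubst (Fin m) ℂ A) := by
  refine Matrix.ext fun b c => ?_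
  simp only [tensorSliceMatrix_apply, actTensor_fst_apply, Matrix.map_apply, map_sum, map_mul,
    linSubst_X, linSubst_C, Finset.mul_sum, Finset.sum_mul, smul_eq_C_mul]
  rw [Finset.sum_comm]
  exact Finset.sum_congr rfl fun a' _ => Finset.sum_congr rfl fun a _ => by ring

/-- `S((1 ⊗ 1 ⊗ g₃)·w) = S(w) · det g₃`. [cite: BurgisserIkenmeyer2017, §5 eq. (5.1)] -/
theorem tensorSliceDet_actTensor_thd (G : Matrix (Fin m) (Fin m) ℂ)
    (w : Fin m → Fin m → Fin m → ℂ) :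
    tensorSliceDet (actTensor (1 : Matrix (Fin m) (Fin m) ℂ) (1 : Matrix (Fin m) (Fin m) ℂ) G w) =
      tensorSliceDet w * C G.det := by
  rw [tensorSliceDet, tensorSliceMatrix_actTensor_thd, Matrix.det_mul, Matrix.det_transpose,
    ← RingHom.mapMatrix_apply, ← RingHom.map_det]
  rfl

/-- `S((1 ⊗ g₂ ⊗ 1)·w) = det g₂ · S(w)`. [cite: BurgisserIkenmeyer2017, §5 eq. (5.1)] -/
theorem tensorSliceDet_actTensor_snd (B : Matrix (Fin m) (Fin m) ℂ)
    (w : Fin m → Fin m → Fin m → ℂ) :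
    tensorSliceDet (actTensor (1 : Matrix (Fin m) (Fin m) ℂ) B (1 : Matrix (Fin m) (Fin m) ℂ) w) =
      C B.det * tensorSliceDet w := by
  rw [tensorSliceDet, tensorSliceMatrix_actTensor_snd, Matrix.det_mul, ← RingHom.mapMatrix_apply,
    ← RingHom.map_det]
  rfl

/-- `S((g₁ ⊗ 1 ⊗ 1)·w) = g₁ · S(w)` (linear substitution commutes with the determinant).
[cite: BurgisserIkenmeyer2017, §5 eq. (5.1)] -/
theorem tensorSliceDet_actTensor_fst (A : Matrix (Fin m) (Fin m) ℂ)
    (w : Fin m → Fin m → Fin m → ℂ) :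
    tensorSliceDet (actTensor A (1 : Matrix (Fin m) (Fin m) ℂ) (1 : Matrix (Fin m) (Fin m) ℂ) w) =
      linSubst (Fin m) ℂ A (tensorSliceDet w) := by
  rw [tensorSliceDet, tensorSliceMatrix_actTensor_fst, ← AlgHom.mapMatrix_apply, ← AlgHom.map_det]
  rfl

/-- **Transformation law of the slice determinant**: `S((g₁ ⊗ g₂ ⊗ g₃)·w) = det g₂ · det g₃ · (g₁ · S(w))`
for arbitrary square matrices `g₁, g₂, g₃`. [cite: BurgisserIkenmeyer2017, §5 eq. (5.1)] -/
theorem tensorSliceDet_actTensor (A B G : Matrix (Fin m) (Fin m) ℂ)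
    (w : Fin m → Fin m → Fin m → ℂ) :
    tensorSliceDet (actTensor A B G w) =
      C B.det * C G.det * linSubst (Fin m) ℂ A (tensorSliceDet w) := by
  have h : actTensor A B G w =
      actTensor A (1 : Matrix (Fin m) (Fin m) ℂ) (1 : Matrix (Fin m) (Fin m) ℂ)
        (actTensor (1 : Matrix (Fin m) (Fin m) ℂ) B (1 : Matrix (Fin m) (Fin m) ℂ)
          (actTensor (1 : Matrix (Fin m) (Fin m) ℂ) (1 : Matrix (Fin m) (Fin m) ℂ) G w)) := by
    simp only [actTensor_actTensor, Matrix.mul_one, Matrix.one_mul]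
  rw [h, tensorSliceDet_actTensor_fst, tensorSliceDet_actTensor_snd, tensorSliceDet_actTensor_thd,
    map_mul, map_mul, linSubst_C, linSubst_C]
  ring

/-- For `g₁, g₂, g₃ ∈ SL_m`: `S((g₁ ⊗ g₂ ⊗ g₃)·w) = g₁ · S(w)`. [cite: BurgisserIkenmeyer2017, §5 eq. (5.1)] -/
theorem tensorSliceDet_actTensor_sl (g₁ g₂ g₃ : Matrix.SpecialLinearGroup (Fin m) ℂ)
    (w : Fin m → Fin m → Fin m → ℂ) :
    tensorSliceDet (actTensor (g₁ : Matrix (Fin m) (Fin m) ℂ) (g₂ : Matrix (Fin m) (Fin m) ℂ)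
        (g₃ : Matrix (Fin m) (Fin m) ℂ) w) =
      linSubst (Fin m) ℂ (g₁ : Matrix (Fin m) (Fin m) ℂ) (tensorSliceDet w) := by
  rw [tensorSliceDet_actTensor, g₂.det_coe, g₃.det_coe, C_1, one_mul, one_mul]

/-- The slice matrix of the unit tensor `⟨m⟩` is `diag(x_1,…,x_m)`. [cite: BurgisserIkenmeyer2017, §5 eq. (5.1)] -/
theorem tensorSliceMatrix_unitTensor (m : ℕ) :
    tensorSliceMatrix (unitTensor ℂ m) = Matrix.diagonal X := by
  refine Matrix.ext fun b c => ?_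
  simp only [tensorSliceMatrix_apply, unitTensor_apply, Matrix.diagonal_apply]
  by_cases hbc : b = c
  · subst hbc
    simp
  · simp [hbc]

/-- **The slice determinant of the unit tensor is the Chow monomial**: `S(⟨m⟩) = x_1 ⋯ x_m`.
[cite: BurgisserIkenmeyer2017, §5 eq. (5.1)] -/
theorem tensorSliceDet_unitTensor (m : ℕ) :
    tensorSliceDet (unitTensor ℂ m) = ∏ a : Fin m, X a := by
  rw [tensorSliceDet, tensorSliceMatrix_unitTensor, Matrix.det_diagonal]

end SliceDet

/-! ### The generic slice determinant and the transfer `F ↦ Φ_F` of form invariants to tensors -/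

section Transfer

variable {m : ℕ}

/-- The **generic slice matrix** `∑_a x_a ⊗ X_{(a,b,c)}`: the slice matrix of the generic tensor, with
entries in `ℂ[⊗³ℂ^m][x_1,…,x_m]`. [cite: BurgisserIkenmeyer2017, §5 eq. (5.1)] -/
def genericSliceMatrix (m : ℕ) :
    Matrix (Fin m) (Fin m) (MvPolynomial (Fin m) (MvPolynomial (Fin m × Fin m × Fin m) ℂ)) :=
  Matrix.of fun b c => ∑ a, X a * C (X (a, b, c))

/-- The **generic slice determinant** `det(∑_a x_a ⊗ X_{(a,b,c)})`, a polynomial in `x_1,…,x_m` whose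
coefficients are polynomial functions on `⊗³ℂ^m`. [cite: BurgisserIkenmeyer2017, §5 eq. (5.1)] -/
def genericSliceDet (m : ℕ) : MvPolynomial (Fin m) (MvPolynomial (Fin m × Fin m × Fin m) ℂ) :=
  (genericSliceMatrix m).det

/-- The **slice-determinant transfer** `Φ_F` of a polynomial function `F` on `Sym^m ℂ^m` (coordinates
the degree-`m` monomials `DegIdx (Fin m) m`) to a polynomial function on `⊗³ℂ^m`: substitute for the
coordinate `X_μ` the `x^μ`-coefficient of the generic slice determinant, so that
`Φ_F(w) = F(S(w))` (`aeval_tensorPt_sliceDetTransfer`). [cite: BurgisserIkenmeyer2017, §5 eq. (5.1)] -/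
def sliceDetTransfer (F : MvPolynomial (DegIdx (Fin m) m) ℂ) :
    MvPolynomial (Fin m × Fin m × Fin m) ℂ :=
  aeval (fun μ : DegIdx (Fin m) m => coeff μ.1 (genericSliceDet m)) F

/-- Specializing the generic slice determinant at a tensor `w` (coefficientwise evaluation at the
point `w` of `⊗³`) gives the slice determinant `S(w)`. [cite: BurgisserIkenmeyer2017, §5 eq. (5.1)] -/
theorem map_eval_tensorPt_genericSliceDet (w : Fin m → Fin m → Fin m → ℂ) :
    MvPolynomial.map (eval (tensorPt w)) (genericSliceDet m) = tensorSliceDet w := by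
  rw [genericSliceDet, RingHom.map_det, RingHom.mapMatrix_apply, tensorSliceDet]
  congr 1
  refine Matrix.ext fun b c => ?_
  simp only [genericSliceMatrix, tensorSliceMatrix, Matrix.map_apply, Matrix.of_apply, map_sum,
    map_mul, map_X, map_C, eval_X]
  rfl

/-- **`Φ_F(w) = F(S(w))`**: the transfer evaluates at a tensor `w` to `F` at the degree-`m`
coefficient vector of the slice determinant of `w`. [cite: BurgisserIkenmeyer2017, §5 eq. (5.1)] -/
theorem aeval_tensorPt_sliceDetTransfer (w : Fin m → Fin m → Fin m → ℂ)
    (F : MvPolynomial (DegIdx (Fin m) m) ℂ) :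
    aeval (tensorPt w) (sliceDetTransfer F) = aeval (formCoeff m (tensorSliceDet w)) F := by
  have hfun : (fun μ : DegIdx (Fin m) m => aeval (tensorPt w) (coeff μ.1 (genericSliceDet m))) =
      formCoeff m (tensorSliceDet w) := by
    funext μ
    rw [formCoeff_apply, ← map_eval_tensorPt_genericSliceDet w, coeff_map]
    rfl
  rw [sliceDetTransfer, comp_aeval_apply, hfun]

/-- **`Φ_F(⟨m⟩) = F(x_1⋯x_m)`**. [cite: BurgisserIkenmeyer2017, §5 eq. (5.1)] -/
theorem aeval_unitTensor_sliceDetTransfer (F : MvPolynomial (DegIdx (Fin m) m) ℂ) :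
    aeval (tensorPt (unitTensor ℂ m)) (sliceDetTransfer F) =
      aeval (formCoeff m (∏ a : Fin m, X a : MvPolynomial (Fin m) ℂ)) F := by
  rw [aeval_tensorPt_sliceDetTransfer, tensorSliceDet_unitTensor]

/-- **`Φ_F` is `SL³_m`-invariant** when `F` is an `SL_m`-invariant on `Sym^m ℂ^m`:
`Φ_F((g₁ ⊗ g₂ ⊗ g₃)·w) = F(g₁ · S(w)) = F(S(w))`. [cite: BurgisserIkenmeyer2017, §5 eq. (5.1)] -/
theorem isSL3Invariant_sliceDetTransfer {F : MvPolynomial (DegIdx (Fin m) m) ℂ}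
    (hF : IsSLInvariantCoord m F) : IsSL3Invariant (sliceDetTransfer F) := by
  intro g₁ g₂ g₃ w
  rw [aeval_tensorPt_sliceDetTransfer, aeval_tensorPt_sliceDetTransfer, tensorSliceDet_actTensor_sl]
  exact hF.aeval_formCoeff_linSubst g₁ _

/-- A product of variables is the monomial of the sum of their exponent vectors (over any
commutative semiring of coefficients). [folklore] -/
private theorem prod_X_eq_monomial_sum_single {R σ ι : Type*} [CommSemiring R] [Fintype ι]
    (φ : ι → σ) :
    (∏ i, X (φ i) : MvPolynomial σ R) = monomial (∑ i, Finsupp.single (φ i) 1) 1 := by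
  rw [monomial_sum_index, C_1, one_mul]
  rfl

/-- **The coefficients of the generic slice determinant are forms of degree `m` on `⊗³ℂ^m`**: by the
Leibniz expansion, the `x^μ`-coefficient of `det(∑_a x_a ⊗ X_{(a,b,c)})` is
`∑_σ sgn σ ∑_{φ : content(φ) = μ} ∏_i X_{(φ i, σ i, i)}`. [cite: BurgisserIkenmeyer2017, §5 eq. (5.1)] -/
theorem isHomogeneous_coeff_genericSliceDet (μ : Fin m →₀ ℕ) :
    (coeff μ (genericSliceDet m)).IsHomogeneous m := by
  classical
  rw [genericSliceDet, Matrix.det_apply', coeff_sum]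
  refine IsHomogeneous.sum _ _ _ fun σ _ => ?_
  rw [← map_intCast (C : MvPolynomial (Fin m × Fin m × Fin m) ℂ →+* _), coeff_C_mul,
    ← map_intCast (C : ℂ →+* MvPolynomial (Fin m × Fin m × Fin m) ℂ)]
  refine IsHomogeneous.C_mul ?_ _
  simp only [genericSliceMatrix, Matrix.of_apply]
  rw [Fintype.prod_sum, coeff_sum]
  refine IsHomogeneous.sum _ _ _ fun φ _ => ?_
  have hprod : (∏ i, X (φ i) * C (X (φ i, σ i, i)) :
      MvPolynomial (Fin m) (MvPolynomial (Fin m × Fin m × Fin m) ℂ)) =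
      monomial (∑ i, Finsupp.single (φ i) 1) (∏ i, X (φ i, σ i, i)) := by
    rw [Finset.prod_mul_distrib, prod_X_eq_monomial_sum_single, ← map_prod C, mul_comm,
      C_mul_monomial, mul_one]
  rw [hprod, coeff_monomial]
  split_ifs
  · have h := IsHomogeneous.prod (Finset.univ : Finset (Fin m))
      (fun i => (X (φ i, σ i, i) : MvPolynomial (Fin m × Fin m × Fin m) ℂ)) (fun _ => 1)
      fun i _ => isHomogeneous_X _ _
    simpa using h
  · exact isHomogeneous_zero _ _ _

/-- **`Φ_F` is homogeneous of degree `m d`** for `F` homogeneous of degree `d`.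
[cite: BurgisserIkenmeyer2017, §5 eq. (5.1)] -/
theorem isHomogeneous_sliceDetTransfer {F : MvPolynomial (DegIdx (Fin m) m) ℂ} {d : ℕ}
    (hF : F.IsHomogeneous d) : (sliceDetTransfer F).IsHomogeneous (m * d) :=
  hF.aeval _ fun μ => isHomogeneous_coeff_genericSliceDet μ.1

end Transfer

/-! ### `e(m) > 0` and the discharge of `BI2017_thm_5_9` -/

section Positivity

variable {m : ℕ}

/-- **Transfer of form invariants to tensor invariants**: a homogeneous `SL_m`-invariant `F` of degree
`d` on `Sym^m ℂ^m` with `F(x_1⋯x_m) ≠ 0` yields `m d ∈ E(m)`, the generic degree monoid of `⊗³ℂ^m`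
(witness `Φ_F`). [cite: BurgisserIkenmeyer2017, §5 eq. (5.1)] -/
theorem mul_mem_genericTensorDegreeMonoid_of_isSLInvariantCoord
    {F : MvPolynomial (DegIdx (Fin m) m) ℂ} {d : ℕ} (hFd : F.IsHomogeneous d)
    (hFi : IsSLInvariantCoord m F)
    (hFw : aeval (formCoeff m (∏ a : Fin m, X a : MvPolynomial (Fin m) ℂ)) F ≠ 0) :
    m * d ∈ genericTensorDegreeMonoid (Fin m) ℂ := by
  refine ⟨sliceDetTransfer F, isHomogeneous_sliceDetTransfer hFd,
    isSL3Invariant_sliceDetTransfer hFi, fun h0 => hFw ?_⟩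
  rw [← aeval_unitTensor_sliceDetTransfer, h0, map_zero]

/-- **`e(m) > 0` for `m ≥ 1`**: the generic degree monoid `E(m) = {d | O(⊗³ℂ^m)^{SL³_m}_d ≠ 0}`
(BI 2017 eq. (5.1)) has a positive element, so its minimal positive element `e(m)`
(`genericTensorMinimalDegree`, an `sInf`) is positive — the slice-determinant transfer `Φ_F` of a
Hilbert invariant `F` of the polystable Chow monomial `x_1⋯x_m` (BI 2017 Cor. 2.9;
Mumford–Fogarty–Kirwan Ch. 2 §1 Prop. 2.2, the tree's
`exists_isSLInvariantCoord_aeval_formCoeff_ne_zero`). [cite: BurgisserIkenmeyer2017, §5 eq. (5.1)] -/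
theorem genericTensorMinimalDegree_pos (hm : 0 < m) : 0 < genericTensorMinimalDegree (Fin m) ℂ := by
  have hhom : (∏ a : Fin m, X a : MvPolynomial (Fin m) ℂ).IsHomogeneous m := by
    have h := IsHomogeneous.prod (Finset.univ : Finset (Fin m))
      (fun a => (X a : MvPolynomial (Fin m) ℂ)) (fun _ => 1) fun a _ => isHomogeneous_X _ _
    simpa using h
  have hne : (∏ a : Fin m, X a : MvPolynomial (Fin m) ℂ) ≠ 0 := by
    intro h
    have h1 := congrArg (eval fun _ : Fin m => (1 : ℂ)) h
    simp at h1
  obtain ⟨F, d, hd, hFd, hFi, hFw⟩ :=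
    exists_isSLInvariantCoord_aeval_formCoeff_ne_zero hm hhom hne (isPolystable_prod_X m)
  have hS : {e | e ∈ genericTensorDegreeMonoid (Fin m) ℂ ∧ 0 < e}.Nonempty :=
    ⟨m * d, mul_mem_genericTensorDegreeMonoid_of_isSLInvariantCoord hFd hFi hFw, Nat.mul_pos hm hd⟩
  exact (Nat.sInf_mem hS).2

/-- **BI 2017, Thm. 5.9 — DISCHARGED** (L2122, p0019:L3): `theorem BI2017_thm_5_9_holds :
BI2017_thm_5_9`. Parts (2) (Alon–Tarsi ⇒ `e(m) ≤ m²`), (3) (`k_{n²}(n) = 1`, `e(n²) = n³`) and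
(1) given `e(m) > 0` (`m ∣ e(m)`, `m ≤ (e(m)/m)²`) are the sibling's `BI2017_thm_5_9_of_pos`
(`BI17SL3InvariantDimensionProofs.lean`); the positivity `e(m) > 0` is
`genericTensorMinimalDegree_pos` above. [cite: BurgisserIkenmeyer2017, Thm. 5.9] -/
theorem BI2017_thm_5_9_holds : BI2017_thm_5_9 :=
  BI2017_thm_5_9_of_pos fun _ hm => genericTensorMinimalDegree_pos (by omega)

end Positivity

end Literature.Computability.AlgebraicComplexity

end
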